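import Summits.KontsevichZagierPeriods.KontsevichZagierPeriods.Theses.AttractorUnfolding

/-!
# `Assembly` (stmt-KontsevichZagierPeriods-11365, route AttractorUnfolding) — proof

The route's assembly item `FibrewiseCauchy → FibrewiseResidue → ResidueKernel →
KontsevichZagierPeriods` is VERBATIM the type of its gate-verified deciding theorem
`Summit.KontsevichZagierPeriods.KontsevichZagierPeriods.Theses.AttractorUnfolding.closes`, read as
an implication; the three antecedents are the route's open cruxes and are NOT discharged here.
(lead c10 of crux stmt-KontsevichZagierPeriods-9129, banking.) No definitions are introduced.
-/

namespace Summit.KontsevichZagierPeriods.AttractorUnfolding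

/-- **Assembly of route AttractorUnfolding** (stmt-KontsevichZagierPeriods-11365):
`FibrewiseCauchy → FibrewiseResidue → ResidueKernel → KontsevichZagierPeriods` — the cruxes imply
the summit, by the route's deciding theorem `closes`. [Kontsevich–Zagier 2001, §1.2] [folklore] -/
theorem assembly_proof :
    Summit.KontsevichZagierPeriods.KontsevichZagierPeriods.Theses.AttractorUnfolding.Assembly :=
  fun h₁ h₂ h₃ =>
    Summit.KontsevichZagierPeriods.KontsevichZagierPeriods.Theses.AttractorUnfolding.closes h₁ h₂ h₃

end Summit.KontsevichZagierPeriods.AttractorUnfolding
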